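import Summits.KontsevichZagierPeriods.KontsevichZagierPeriods.Theorems.HurwitzMicroSectorsNormalFormPrincipleM4SharedTools
import Summits.KontsevichZagierPeriods.KontsevichZagierPeriods.Theorems.HurwitzMicroSectorsNormalFormPrincipleM4BoxSubSimplex4
import Summits.KontsevichZagierPeriods.KontsevichZagierPeriods.Theorems.HurwitzMicroSectorsNormalFormPrincipleM4LogTimesNegZetaThree
import Summits.KontsevichZagierPeriods.KontsevichZagierPeriods.Theorems.HyperbolicBlochOffTetraSectorKernelStubAffineOrbit

/-!
# `NormalFormPrinciple` (stmt-KontsevichZagierPeriods-3869), line `SketchIdeator1` —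
# leaf `stub_boxRigidity`, layer `M4` packages: box-stuffle `P(c;aac) = [aaab] − [aacb] − [caab]`

Pure proof file (registered sub-goal `m4_rel_bstuffle13p` of stmt-KontsevichZagierPeriods-3869,
line `SketchIdeator1`, lead seat c9; layer `M4` packages of the dimension-four campaign of the
leaf `stub_boxRigidity`; `--supports` the crux). Letters on `(0,1)`: `a(u) = 1/u`,
`b(u) = 1/(1−u)`, `c(u) = 1/(1+u)`; words `[x y z w] = [Δ₄, x(t₀)y(t₁)z(t₂)w(t₃)]` on the
decreasing open simplex `Δ₄ = {1 > t₀ > t₁ > t₂ > t₃ > 0}`. The row proved is the quasi-shuffle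
(stuffle) `[c] ⋆ [aac]`: `[C1 × aac] − [aaab] + [aacb] + [caab] ∈ KZ.relations`
(`log 2 · η(3) = ζ(4) − Σ_{m<n} − Σ_{m>n}`) for the interval `C1 = [(0,1), 1/(1+x)]` and arbitrary
word carriers. Inside the Kontsevich–Zagier calculus the stuffle is ONE integrand-additivity move
on the PRODUCT BOX (the three-term partial fraction
`1/((1+u)(1+v)) = 1/((1+u)(1−uv)) + 1/((1+v)(1−uv)) − 1/(1−uv)`, `u = x₀`, `v = x₁x₂x₃`)
+ a coordinate permutation (the middle term is a nested box in the rotated variable order)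
+ cubical charts `□⁴ → Δ₄`, `□³ → Δ₃` (rule 2) and two-term splits `1/((1+t)t) = 1/t − 1/(1+t)`
(rule 1b); `[C1 × □³-box] ∼ [C1 × aac]` is the product ideal (`KZ.Equivalent.prod`).
Sources: M. Kontsevich, D. Zagier, *Periods* (2001), §1.1–1.2, §4.1; M. E. Hoffman, *The algebra
of multiple harmonic series*, J. Algebra 194 (1997) (quasi-shuffle). No definitions are introduced.
-/

noncomputable section

open MeasureTheory Set
open Literature.NumberTheory.Transcendental Literature.NumberTheory.Transcendental.KZ
open Literature.ModelTheory.ExponentialFields (IsSemialgebraic)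
open Summit.KontsevichZagierPeriods.HyperbolicBloch.OffTetraSectorKernel
  (aff_orbit_of_sub_sum_zsmul_mem_relations)

namespace Summit.KontsevichZagierPeriods.HurwitzMicroSectors.NormalFormPrinciple.PiBox.M3

/-! ## Tools: carriers `[D, 1/q]` by domination, coordinate facts -/

/-- **A representation `[D, 1/q]` exists by domination.** If `F = 1/q` for a `ℚ`-polynomial `q`
bounded below on the `ℚ`-semialgebraic set `D` by a positive function `d` with `1/d` integrable
on `D`, then `[D, F]` is an integral representation. [cite: KontsevichZagier2001, §1.1] -/
theorem m4i_exists_rep_inv {k : ℕ} {D : Set (Fin k → ℝ)} (hD : IsSemialgebraic ℚ D)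
    {d : (Fin k → ℝ) → ℝ} (hd : IntegrableOn (fun x => 1 / d x) D)
    (F : (Fin k → ℝ) → ℝ) (q : MvPolynomial (Fin k) ℚ)
    (hF : ∀ x, F x = 1 / MvPolynomial.aeval x q)
    (hq : ∀ x ∈ D, 0 < d x ∧ d x ≤ MvPolynomial.aeval x q) :
    ∃ N : IntegralRep k, N.domain = D ∧ N.integrand = F := by
  have hq0 : ∀ x ∈ D, (MvPolynomial.aeval x q : ℝ) ≠ 0 := fun x hx =>
    ((hq x hx).1.trans_le (hq x hx).2).ne'
  have hsa : IsSemialgebraicFunOn ℚ D F :=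
    (isSemialgebraicFunOn_aeval_div_aeval hD 1 q hq0).congr fun x _ => by
      simp only [hF, map_one]
  have hc : ContinuousOn F D :=
    (continuousOn_const.div
      (Literature.ModelTheory.ExponentialFields.continuous_aeval_real q).continuousOn hq0).congr
      fun x _ => hF x
  refine ⟨⟨D, F, hD, hsa, ?_⟩, rfl, rfl⟩
  refine Integrable.mono' hd (hc.aestronglyMeasurable hD.measurableSet_holds) ?_
  refine (ae_restrict_iff' hD.measurableSet_holds).2 (Filter.Eventually.of_forall fun x hx => ?_)
  have hp : 0 < (MvPolynomial.aeval x q : ℝ) := (hq x hx).1.trans_le (hq x hx).2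
  rw [Real.norm_eq_abs, hF x, abs_of_pos (one_div_pos.2 hp)]
  exact one_div_le_one_div_of_le (hq x hx).1 (hq x hx).2

/-- Positivity facts on the open unit box `□⁴`. [folklore] -/
theorem m4i_box_facts {x : Fin 4 → ℝ} (hx : ∀ i, x i ∈ Set.Ioo (0:ℝ) 1) :
    0 < x 0 ∧ 0 < x 1 ∧ 0 < x 2 ∧ 0 < x 1 * x 2 * x 3 ∧ 0 < x 0 * x 1 * x 2 ∧
      0 < 1 - x 0 * x 1 * x 2 * x 3 := by
  have h01 : x 0 * x 1 < 1 := mul_lt_one_of_nonneg_of_lt_one_left (hx 0).1.le (hx 0).2 (hx 1).2.le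
  have h012 : x 0 * x 1 * x 2 < 1 :=
    mul_lt_one_of_nonneg_of_lt_one_left (mul_pos (hx 0).1 (hx 1).1).le h01 (hx 2).2.le
  refine ⟨(hx 0).1, (hx 1).1, (hx 2).1, mul_pos (mul_pos (hx 1).1 (hx 2).1) (hx 3).1,
    mul_pos (mul_pos (hx 0).1 (hx 1).1) (hx 2).1, sub_pos.2 ?_⟩
  exact mul_lt_one_of_nonneg_of_lt_one_left (mul_pos (mul_pos (hx 0).1 (hx 1).1) (hx 2).1).le
    h012 (hx 3).2.le

/-- Positivity facts on the decreasing open simplex `Δ₄`. [folklore] -/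
theorem m4i_simplex_facts {t : Fin 4 → ℝ}
    (ht : t ∈ {t : Fin 4 → ℝ | 0 < t 3 ∧ t 3 < t 2 ∧ t 2 < t 1 ∧ t 1 < t 0 ∧ t 0 < 1}) :
    0 < t 0 ∧ 0 < t 1 ∧ 0 < t 2 ∧ 0 < 1 - t 3 ∧ 0 < t 0 * t 1 * t 2 * (1 - t 3) := by
  have h := m4s_mem_Ioo_of_mem_simplex4 ht
  have h0 := (h 0).1
  have h1 := (h 1).1
  have h2 := (h 2).1
  have h3 : 0 < 1 - t 3 := sub_pos.2 (h 3).2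
  exact ⟨h0, h1, h2, h3, by positivity⟩

/-- The `ζ(4)` box integrand `1/(1 − x₀x₁x₂x₃)` is integrable on `□⁴` (it is the integrand of the
level-one box `m4t_exists_minusBox4`). [cite: KontsevichZagier2001, §1.1] -/
theorem m4i_integrableOn_boxG :
    IntegrableOn (fun x : Fin 4 → ℝ => 1 / (1 - x 0 * x 1 * x 2 * x 3))
      {x : Fin 4 → ℝ | ∀ i, x i ∈ Set.Ioo (0:ℝ) 1} := by
  obtain ⟨Z, hZd, hZi⟩ := m4t_exists_minusBox4
  have h := Z.integrableOn
  rw [hZd, hZi] at h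
  exact h

/-- The `ζ(4)` kernel `1/(t₀t₁t₂(1−t₃))` is integrable on `Δ₄` as soon as a word carrier `[aaab]`
is given. [cite: KontsevichZagier2001, §1.1] -/
theorem m4i_integrableOn_G (AAAB : IntegralRep 4)
    (hAAABd : AAAB.domain = {t | 0 < t 3 ∧ t 3 < t 2 ∧ t 2 < t 1 ∧ t 1 < t 0 ∧ t 0 < 1})
    (hAAABi : AAAB.integrand = fun t => 1 / t 0 * (1 / t 1) * (1 / t 2) * (1 / (1 - t 3))) :
    IntegrableOn (fun t : Fin 4 → ℝ => 1 / (t 0 * t 1 * t 2 * (1 - t 3)))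
      {t : Fin 4 → ℝ | 0 < t 3 ∧ t 3 < t 2 ∧ t 2 < t 1 ∧ t 1 < t 0 ∧ t 0 < 1} := by
  have h := AAAB.integrableOn
  rw [hAAABd, hAAABi] at h
  exact h.congr_fun (fun t _ => by simp only [one_div_mul_one_div]) m4s_measurableSet_simplex4

/-! ## The three box terms of the partial fraction, charted onto words -/

/-- `[□⁴, 1/((1+x₀)(1−x₀x₁x₂x₃))] = [aaab] − [caab]`: the cubical chart (rule 2) onto
`[Δ₄, 1/((1+t₀)t₀t₁t₂(1−t₃))]` (a carrier dominated by `[aaab]`), then rule (1b) with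
`1/((1+t)t) = 1/t − 1/(1+t)`. [cite: KontsevichZagier2001, §1.2 rules (1), (2)] -/
theorem m4i_T1_step (T1 AAAB CAAB : IntegralRep 4)
    (hT1d : T1.domain = {x | ∀ i, x i ∈ Set.Ioo (0:ℝ) 1})
    (hT1i : T1.integrand = fun x => 1 / ((1 + x 0) * (1 - x 0 * x 1 * x 2 * x 3)))
    (hAAABd : AAAB.domain = {t | 0 < t 3 ∧ t 3 < t 2 ∧ t 2 < t 1 ∧ t 1 < t 0 ∧ t 0 < 1})
    (hAAABi : AAAB.integrand = fun t => 1 / t 0 * (1 / t 1) * (1 / t 2) * (1 / (1 - t 3)))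
    (hCAABd : CAAB.domain = {t | 0 < t 3 ∧ t 3 < t 2 ∧ t 2 < t 1 ∧ t 1 < t 0 ∧ t 0 < 1})
    (hCAABi : CAAB.integrand = fun t => 1 / (1 + t 0) * (1 / t 1) * (1 / t 2) * (1 / (1 - t 3))) :
    of T1 - of AAAB + of CAAB ∈ relations := by
  -- the simplex-side carrier, dominated by the `ζ(4)` kernel
  obtain ⟨V, hVd, hVi⟩ := m4i_exists_rep_inv m4s_isSemialgebraic_simplex4
    (m4i_integrableOn_G AAAB hAAABd hAAABi)
    (fun t => 1 / ((1 + t 0) * t 0 * t 1 * t 2 * (1 - t 3)))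
    ((1 + MvPolynomial.X 0) * MvPolynomial.X 0 * MvPolynomial.X 1 * MvPolynomial.X 2 *
      (1 - MvPolynomial.X 3))
    (fun t => by simp only [map_mul, map_add, map_sub, map_one, MvPolynomial.aeval_X])
    fun t ht => by
      obtain ⟨h0, -, -, -, hG⟩ := m4i_simplex_facts ht
      refine ⟨hG, ?_⟩
      simp only [map_mul, map_add, map_sub, map_one, MvPolynomial.aeval_X]
      nlinarith [mul_pos h0 hG]
  -- rule (2): the cubical chart `□⁴ → Δ₄`
  have c1 : of T1 - of V ∈ relations := by
    refine m4_box_sub_simplex4.1 (fun t => 1 / ((1 + t 0) * t 0 * t 1 * t 2 * (1 - t 3))) T1 V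
      hT1d hVd (hVi ▸ fun _ _ => rfl) fun x hx => ?_
    rw [hT1d] at hx
    obtain ⟨h0, h1, h2, -, -, hP⟩ := m4i_box_facts hx
    rw [hT1i]
    simp only [Matrix.cons_val_zero, Matrix.cons_val_one, Matrix.cons_val_two,
      Matrix.cons_val_three, Matrix.head_cons, Matrix.tail_cons]
    field_simp
  -- rule (1b): `1/((1+t₀)t₀t₁t₂(1−t₃)) = [aaab] − [caab]`
  have s1 : of V - ((1:ℤ) • of AAAB + (-1:ℤ) • of CAAB) ∈ relations := by
    have h := aff_orbit_of_sub_sum_zsmul_mem_relations (Finset.univ : Finset (Fin 2))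
      ![AAAB, CAAB] ![1, -1] V (fun i _ => by
        fin_cases i
        · exact hAAABd.trans hVd.symm
        · exact hCAABd.trans hVd.symm) fun t ht => ?_
    · simpa [Fin.sum_univ_two] using h
    rw [hVd] at ht
    obtain ⟨h0, h1, h2, hm3, -⟩ := m4i_simplex_facts ht
    rw [hVi]
    simp only [Fin.sum_univ_two, Matrix.cons_val_zero, Matrix.cons_val_one, hAAABi, hCAABi]
    push_cast
    field_simp
    ring
  have e : of T1 - of AAAB + of CAAB =
      (of T1 - of V) + (of V - ((1:ℤ) • of AAAB + (-1:ℤ) • of CAAB)) := by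
    simp only [one_smul, neg_smul]; abel
  rw [e]
  exact relations.add_mem c1 s1

/-- `[□⁴, 1/((1+x₁x₂x₃)(1−x₀x₁x₂x₃))] = [aaab] − [aacb]`: a coordinate rotation (rule 2,
`KZ.of_sub_of_reindex_mem_relations`) to the nested box `[□⁴, 1/((1+y₀y₁y₂)(1−y₀y₁y₂y₃))]`, the
cubical chart (rule 2) onto `[Δ₄, 1/(t₀t₁t₂(1+t₂)(1−t₃))]`, then rule (1b) with
`1/(t(1+t)) = 1/t − 1/(1+t)`. [cite: KontsevichZagier2001, §1.2 rules (1), (2)] -/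
theorem m4i_T2_step (T2p AAAB AACB : IntegralRep 4)
    (hT2pd : T2p.domain = {x | ∀ i, x i ∈ Set.Ioo (0:ℝ) 1})
    (hT2pi : T2p.integrand = fun x => 1 / ((1 + x 1 * x 2 * x 3) * (1 - x 0 * x 1 * x 2 * x 3)))
    (hAAABd : AAAB.domain = {t | 0 < t 3 ∧ t 3 < t 2 ∧ t 2 < t 1 ∧ t 1 < t 0 ∧ t 0 < 1})
    (hAAABi : AAAB.integrand = fun t => 1 / t 0 * (1 / t 1) * (1 / t 2) * (1 / (1 - t 3)))
    (hAACBd : AACB.domain = {t | 0 < t 3 ∧ t 3 < t 2 ∧ t 2 < t 1 ∧ t 1 < t 0 ∧ t 0 < 1})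
    (hAACBi : AACB.integrand = fun t => 1 / t 0 * (1 / t 1) * (1 / (1 + t 2)) * (1 / (1 - t 3))) :
    of T2p - of AAAB + of AACB ∈ relations := by
  -- the nested box in the standard variable order and the rotation `e = (0 1 2 3) ↦ (1 2 3 0)`
  obtain ⟨T2, hT2d, hT2i⟩ := m4i_exists_rep_inv (isSemialgebraic_box 4) m4i_integrableOn_boxG
    (fun x => 1 / ((1 + x 0 * x 1 * x 2) * (1 - x 0 * x 1 * x 2 * x 3)))
    ((1 + MvPolynomial.X 0 * MvPolynomial.X 1 * MvPolynomial.X 2) *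
      (1 - MvPolynomial.X 0 * MvPolynomial.X 1 * MvPolynomial.X 2 * MvPolynomial.X 3))
    (fun x => by simp only [map_mul, map_add, map_sub, map_one, MvPolynomial.aeval_X])
    fun x hx => by
      obtain ⟨-, -, -, -, hw, hP⟩ := m4i_box_facts hx
      refine ⟨hP, ?_⟩
      simp only [map_mul, map_add, map_sub, map_one, MvPolynomial.aeval_X]
      nlinarith [mul_pos hw hP]
  obtain ⟨e, h0, h1, h2, h3⟩ : ∃ e : Fin 4 ≃ Fin 4, e 0 = 1 ∧ e 1 = 2 ∧ e 2 = 3 ∧ e 3 = 0 :=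
    ⟨⟨![1, 2, 3, 0], ![3, 0, 1, 2], by decide, by decide⟩, rfl, rfl, rfl, rfl⟩
  have p1 : of T2p - of (T2.reindex e) ∈ relations := by
    refine of_sub_of_mem_relations_of_eqOn ?_ fun w _ => ?_
    · rw [IntegralRep.reindex_domain, hT2d, hT2pd]
      ext w
      simp only [mem_setOf_eq]
      exact ⟨fun h i => by simpa using h (e.symm i), fun h i => h (e i)⟩
    · rw [IntegralRep.reindex_integrand, hT2pi, hT2i]
      simp only [h0, h1, h2, h3]
      ring
  have p2 : of T2 - of (T2.reindex e) ∈ relations := of_sub_of_reindex_mem_relations T2 e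
  -- the simplex-side carrier, dominated by the `ζ(4)` kernel
  obtain ⟨V, hVd, hVi⟩ := m4i_exists_rep_inv m4s_isSemialgebraic_simplex4
    (m4i_integrableOn_G AAAB hAAABd hAAABi)
    (fun t => 1 / (t 0 * t 1 * t 2 * (1 + t 2) * (1 - t 3)))
    (MvPolynomial.X 0 * MvPolynomial.X 1 * MvPolynomial.X 2 * (1 + MvPolynomial.X 2) *
      (1 - MvPolynomial.X 3))
    (fun t => by simp only [map_mul, map_add, map_sub, map_one, MvPolynomial.aeval_X])
    fun t ht => by
      obtain ⟨-, -, h2', -, hG⟩ := m4i_simplex_facts ht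
      refine ⟨hG, ?_⟩
      simp only [map_mul, map_add, map_sub, map_one, MvPolynomial.aeval_X]
      nlinarith [mul_pos h2' hG]
  -- rule (2): the cubical chart `□⁴ → Δ₄`
  have c2 : of T2 - of V ∈ relations := by
    refine m4_box_sub_simplex4.1 (fun t => 1 / (t 0 * t 1 * t 2 * (1 + t 2) * (1 - t 3))) T2 V
      hT2d hVd (hVi ▸ fun _ _ => rfl) fun x hx => ?_
    rw [hT2d] at hx
    obtain ⟨hx0, hx1, hx2, -, hw, hP⟩ := m4i_box_facts hx
    rw [hT2i]
    simp only [Matrix.cons_val_zero, Matrix.cons_val_one, Matrix.cons_val_two,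
      Matrix.cons_val_three, Matrix.head_cons, Matrix.tail_cons]
    field_simp
  -- rule (1b): `1/(t₀t₁t₂(1+t₂)(1−t₃)) = [aaab] − [aacb]`
  have s2 : of V - ((1:ℤ) • of AAAB + (-1:ℤ) • of AACB) ∈ relations := by
    have h := aff_orbit_of_sub_sum_zsmul_mem_relations (Finset.univ : Finset (Fin 2))
      ![AAAB, AACB] ![1, -1] V (fun i _ => by
        fin_cases i
        · exact hAAABd.trans hVd.symm
        · exact hAACBd.trans hVd.symm) fun t ht => ?_
    · simpa [Fin.sum_univ_two] using h
    rw [hVd] at ht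
    obtain ⟨ht0, ht1, ht2, hm3, -⟩ := m4i_simplex_facts ht
    rw [hVi]
    simp only [Fin.sum_univ_two, Matrix.cons_val_zero, Matrix.cons_val_one, hAAABi, hAACBi]
    push_cast
    field_simp
    ring
  have e' : of T2p - of AAAB + of AACB = (of T2p - of (T2.reindex e)) - (of T2 - of (T2.reindex e))
      + (of T2 - of V) + (of V - ((1:ℤ) • of AAAB + (-1:ℤ) • of AACB)) := by
    simp only [one_smul, neg_smul]; abel
  rw [e']
  exact relations.add_mem (relations.add_mem (relations.sub_mem p1 p2) c2) s2

/-- `[□⁴, 1/(1−x₀x₁x₂x₃)] = [aaab]`: the cubical chart (rule 2), pull-back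
`1/(x₀ · x₀x₁ · x₀x₁x₂ · (1 − x₀x₁x₂x₃)) · x₀³x₁²x₂ = 1/(1 − x₀x₁x₂x₃)`.
[cite: KontsevichZagier2001, §1.2 rule (2)] -/
theorem m4i_T3_step (T3 AAAB : IntegralRep 4)
    (hT3d : T3.domain = {x | ∀ i, x i ∈ Set.Ioo (0:ℝ) 1})
    (hT3i : T3.integrand = fun x => 1 / (1 - x 0 * x 1 * x 2 * x 3))
    (hAAABd : AAAB.domain = {t | 0 < t 3 ∧ t 3 < t 2 ∧ t 2 < t 1 ∧ t 1 < t 0 ∧ t 0 < 1})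
    (hAAABi : AAAB.integrand = fun t => 1 / t 0 * (1 / t 1) * (1 / t 2) * (1 / (1 - t 3))) :
    of T3 - of AAAB ∈ relations := by
  refine m4_box_sub_simplex4.1 (fun t => 1 / t 0 * (1 / t 1) * (1 / t 2) * (1 / (1 - t 3)))
    T3 AAAB hT3d hAAABd (hAAABi ▸ fun _ _ => rfl) fun x hx => ?_
  rw [hT3d] at hx
  obtain ⟨h0, h1, h2, -, -, hP⟩ := m4i_box_facts hx
  rw [hT3i]
  simp only [Matrix.cons_val_zero, Matrix.cons_val_one, Matrix.cons_val_two,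
    Matrix.cons_val_three, Matrix.head_cons, Matrix.tail_cons]
  field_simp

/-! ## The product box and the registered sub-goal -/

/-- **`[C1 × aac]` is congruent to the box `[□⁴, 1/((1+x₀)(1+x₁x₂x₃))]`.** With the box
`B = [□³, 1/(1+y₀y₁y₂)]` (dominated by the `ζ(3)` box): the cubical chart `□³ → Δ₃` (rule 2)
gives `B ∼ [aac]`, the product ideal (`KZ.Equivalent.prod`) gives `C1 × B ∼ C1 × [aac]`, and
`□¹ × □³ = □⁴` is a congruence (`m4b_of_sub_of_prod_mem_relations`).
[cite: KontsevichZagier2001, §1.2 rule (2), §4.1] -/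
theorem m4i_prod_step (C1 : IntegralRep 1) (hC1d : C1.domain = {x | ∀ i, x i ∈ Set.Ioo (0:ℝ) 1})
    (hC1i : C1.integrand = fun x => 1 / (1 + x 0))
    (AAC : IntegralRep 3) (hAACd : AAC.domain = {t | 0 < t 2 ∧ t 2 < t 1 ∧ t 1 < t 0 ∧ t 0 < 1})
    (hAACi : AAC.integrand = fun t => 1 / t 0 * 1 / t 1 * (1 / (1 + t 2)))
    (M : IntegralRep 4) (hMd : M.domain = {x | ∀ i, x i ∈ Set.Ioo (0:ℝ) 1})
    (hMi : M.integrand = fun x => 1 / ((1 + x 0) * (1 + x 1 * x 2 * x 3))) :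
    of M - of (C1.prod AAC) ∈ relations := by
  -- the box `B = [□³, 1/(1 + y₀y₁y₂)]`, dominated by the `ζ(3)` box `[□³, 1/(1 − y₀y₁y₂)]`
  obtain ⟨Z, hZd, hZi⟩ := ebd3_exists_zetaThreeBox
  have hG : IntegrableOn (fun x : Fin 3 → ℝ => 1 / (1 - x 0 * x 1 * x 2))
      {x : Fin 3 → ℝ | ∀ i, x i ∈ Set.Ioo (0:ℝ) 1} := by
    have h := Z.integrableOn
    rw [hZd, hZi] at h
    exact h
  obtain ⟨B, hBd, hBi⟩ := m4i_exists_rep_inv (isSemialgebraic_box 3) hG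
    (fun x => 1 / (1 + x 0 * x 1 * x 2))
    (1 + MvPolynomial.X 0 * MvPolynomial.X 1 * MvPolynomial.X 2)
    (fun x => by simp only [map_add, map_one, map_mul, MvPolynomial.aeval_X]) fun x hx => by
      have hp : 0 < x 0 * x 1 * x 2 := mul_pos (mul_pos (hx 0).1 (hx 1).1) (hx 2).1
      have hlt : x 0 * x 1 * x 2 < 1 :=
        mul_lt_one_of_nonneg_of_lt_one_left (mul_pos (hx 0).1 (hx 1).1).le
          (mul_lt_one_of_nonneg_of_lt_one_left (hx 0).1.le (hx 0).2 (hx 1).2.le) (hx 2).2.le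
      refine ⟨sub_pos.2 hlt, ?_⟩
      simp only [map_add, map_one, map_mul, MvPolynomial.aeval_X]
      linarith
  -- rule (2): the cubical chart `□³ → Δ₃` takes `B` to `[aac]`
  have hBA : Equivalent B AAC := by
    show of B - of AAC ∈ relations
    refine ebd_box_sub_simplex (fun t => 1 / t 0 * 1 / t 1 * (1 / (1 + t 2))) B AAC hBd hAACd
      (hAACi ▸ fun _ _ => rfl) fun x hx => ?_
    rw [hBd] at hx
    obtain ⟨h0, h1, h2⟩ : 0 < x 0 ∧ 0 < x 1 ∧ 0 < x 2 := ⟨(hx 0).1, (hx 1).1, (hx 2).1⟩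
    rw [hBi]
    simp only [Matrix.cons_val_zero, Matrix.cons_val_one, Matrix.cons_val_two, Matrix.head_cons,
      Matrix.tail_cons]
    field_simp
  -- the product ideal and the congruence `M ≡ C1 × B`
  have hC : Equivalent C1 C1 := by
    show of C1 - of C1 ∈ relations
    rw [sub_self]
    exact relations.zero_mem
  have hP : of (C1.prod B) - of (C1.prod AAC) ∈ relations := hC.prod hBA
  have cM : of M - of (C1.prod B) ∈ relations :=
    m4b_of_sub_of_prod_mem_relations C1 B hC1d hBd M hMd fun x _ => by
      rw [hMi, hC1i, hBi]
      show 1 / ((1 + x 0) * (1 + x 1 * x 2 * x 3)) = 1 / (1 + x 0) * (1 / (1 + x 1 * x 2 * x 3))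
      rw [one_div_mul_one_div]
  have e : of M - of (C1.prod AAC) =
      (of M - of (C1.prod B)) + (of (C1.prod B) - of (C1.prod AAC)) := by abel
  rw [e]
  exact relations.add_mem cM hP

/-- **Stub `m4_rel_bstuffle13p` (registered sub-goal of stmt-KontsevichZagierPeriods-3869, line
`SketchIdeator1`, layer `M4` packages).** The box-stuffle `[c] ⋆ [aac]`:
`[C1 × aac] − [aaab] + [aacb] + [caab] ∈ KZ.relations` for the interval `C1 = [(0,1), 1/(1+x)]`
and arbitrary word carriers with the displayed integrands — the product box
`[□⁴, 1/((1+x₀)(1+x₁x₂x₃))]` splits by the three-term partial fraction (ONE rule-(1b) move)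
into `[□⁴, 1/((1+x₀)(1−Π))] + [□⁴, 1/((1+x₁x₂x₃)(1−Π))] − [□⁴, 1/(1−Π)]`, `Π = x₀x₁x₂x₃`, and
these are `[aaab] − [caab]`, `[aaab] − [aacb]` (after a coordinate rotation), `[aaab]` by cubical
charts (rule 2) and two-term splits (rule 1b).
[cite: KontsevichZagier2001, §1.2 rules (1), (2), §4.1] -/
theorem m4_rel_bstuffle13p :
    ∀ (C1 : IntegralRep 1), C1.domain = {x | ∀ i, x i ∈ Set.Ioo (0:ℝ) 1} → (C1.integrand = fun x => 1 / (1 + x 0)) →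
      ∀ (AAC : IntegralRep 3), AAC.domain = {t | 0 < t 2 ∧ t 2 < t 1 ∧ t 1 < t 0 ∧ t 0 < 1} → (AAC.integrand = fun t => 1 / t 0 * 1 / t 1 * (1 / (1 + t 2))) →
      ∀ (AAAB : IntegralRep 4), AAAB.domain = {t | 0 < t 3 ∧ t 3 < t 2 ∧ t 2 < t 1 ∧ t 1 < t 0 ∧ t 0 < 1} → (AAAB.integrand = fun t => 1 / t 0 * (1 / t 1) * (1 / t 2) * (1 / (1 - t 3))) →
      ∀ (AACB : IntegralRep 4), AACB.domain = {t | 0 < t 3 ∧ t 3 < t 2 ∧ t 2 < t 1 ∧ t 1 < t 0 ∧ t 0 < 1} → (AACB.integrand = fun t => 1 / t 0 * (1 / t 1) * (1 / (1 + t 2)) * (1 / (1 - t 3))) →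
      ∀ (CAAB : IntegralRep 4), CAAB.domain = {t | 0 < t 3 ∧ t 3 < t 2 ∧ t 2 < t 1 ∧ t 1 < t 0 ∧ t 0 < 1} → (CAAB.integrand = fun t => 1 / (1 + t 0) * (1 / t 1) * (1 / t 2) * (1 / (1 - t 3))) →
      of (C1.prod AAC) - of AAAB + of AACB + of CAAB ∈ relations := by
  intro C1 hC1d hC1i AAC hAACd hAACi AAAB hAAABd hAAABi AACB hAACBd hAACBi CAAB hCAABd hCAABi
  -- the box carriers `M = [□⁴, 1/((1+x₀)(1+x₁x₂x₃))]`, `T1`, `T2p`, `T3`, dominated by `1/(1 − Π)`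
  obtain ⟨M, hMd, hMi⟩ := m4i_exists_rep_inv (isSemialgebraic_box 4) m4i_integrableOn_boxG
    (fun x => 1 / ((1 + x 0) * (1 + x 1 * x 2 * x 3)))
    ((1 + MvPolynomial.X 0) * (1 + MvPolynomial.X 1 * MvPolynomial.X 2 * MvPolynomial.X 3))
    (fun x => by simp only [map_mul, map_add, map_one, MvPolynomial.aeval_X]) fun x hx => by
      obtain ⟨h0, -, -, hv, -, hP⟩ := m4i_box_facts hx
      refine ⟨hP, ?_⟩
      simp only [map_mul, map_add, map_one, MvPolynomial.aeval_X]
      nlinarith [mul_pos h0 hv]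
  obtain ⟨T1, hT1d, hT1i⟩ := m4i_exists_rep_inv (isSemialgebraic_box 4) m4i_integrableOn_boxG
    (fun x => 1 / ((1 + x 0) * (1 - x 0 * x 1 * x 2 * x 3)))
    ((1 + MvPolynomial.X 0) *
      (1 - MvPolynomial.X 0 * MvPolynomial.X 1 * MvPolynomial.X 2 * MvPolynomial.X 3))
    (fun x => by simp only [map_mul, map_add, map_sub, map_one, MvPolynomial.aeval_X])
    fun x hx => by
      obtain ⟨h0, -, -, -, -, hP⟩ := m4i_box_facts hx
      refine ⟨hP, ?_⟩
      simp only [map_mul, map_add, map_sub, map_one, MvPolynomial.aeval_X]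
      nlinarith [mul_pos h0 hP]
  obtain ⟨T2p, hT2pd, hT2pi⟩ := m4i_exists_rep_inv (isSemialgebraic_box 4) m4i_integrableOn_boxG
    (fun x => 1 / ((1 + x 1 * x 2 * x 3) * (1 - x 0 * x 1 * x 2 * x 3)))
    ((1 + MvPolynomial.X 1 * MvPolynomial.X 2 * MvPolynomial.X 3) *
      (1 - MvPolynomial.X 0 * MvPolynomial.X 1 * MvPolynomial.X 2 * MvPolynomial.X 3))
    (fun x => by simp only [map_mul, map_add, map_sub, map_one, MvPolynomial.aeval_X])
    fun x hx => by
      obtain ⟨-, -, -, hv, -, hP⟩ := m4i_box_facts hx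
      refine ⟨hP, ?_⟩
      simp only [map_mul, map_add, map_sub, map_one, MvPolynomial.aeval_X]
      nlinarith [mul_pos hv hP]
  obtain ⟨T3, hT3d, hT3i⟩ := m4t_exists_minusBox4
  -- rule (1b) on the product box: the stuffle partial fraction
  have hsplit : of M - ((1:ℤ) • of T1 + (1:ℤ) • of T2p + (-1:ℤ) • of T3) ∈ relations := by
    have h := aff_orbit_of_sub_sum_zsmul_mem_relations (Finset.univ : Finset (Fin 3))
      ![T1, T2p, T3] ![1, 1, -1] M (fun i _ => by
        fin_cases i
        · exact hT1d.trans hMd.symm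
        · exact hT2pd.trans hMd.symm
        · exact hT3d.trans hMd.symm) fun x hx => ?_
    · simpa [Fin.sum_univ_three] using h
    rw [hMd] at hx
    obtain ⟨h0, -, -, hv, -, hP⟩ := m4i_box_facts hx
    rw [hMi]
    simp only [Fin.sum_univ_three, Matrix.cons_val_zero, Matrix.cons_val_one, Matrix.cons_val_two,
      Matrix.head_cons, Matrix.tail_cons, hT1i, hT2pi, hT3i]
    push_cast
    field_simp
    ring
  -- the product step and the three charted terms
  have r0 := m4i_prod_step C1 hC1d hC1i AAC hAACd hAACi M hMd hMi
  have r1 := m4i_T1_step T1 AAAB CAAB hT1d hT1i hAAABd hAAABi hCAABd hCAABi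
  have r2 := m4i_T2_step T2p AAAB AACB hT2pd hT2pi hAAABd hAAABi hAACBd hAACBi
  have r3 := m4i_T3_step T3 AAAB hT3d hT3i hAAABd hAAABi
  have e : of (C1.prod AAC) - of AAAB + of AACB + of CAAB =
      (of M - ((1:ℤ) • of T1 + (1:ℤ) • of T2p + (-1:ℤ) • of T3)) - (of M - of (C1.prod AAC))
        + (of T1 - of AAAB + of CAAB) + (of T2p - of AAAB + of AACB) - (of T3 - of AAAB) := by
    simp only [one_smul, neg_smul]; abel
  rw [e]
  exact relations.sub_mem (relations.add_mem (relations.add_mem (relations.sub_mem hsplit r0)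
    r1) r2) r3

end Summit.KontsevichZagierPeriods.HurwitzMicroSectors.NormalFormPrinciple.PiBox.M3
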